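import Summits.HubbardSuperconductivity.HubbardSuperconductivity.Theorems.AnisotropyChordTransferTheorem

/-!
# Route `AnisotropyChord` / H0 rotor rung, route (1): WHERE COMPRESSIBILITY ENTERS THEOREM T — PROPOSITION N
# (VERBATIM port of the theory seat's `PartH.lean` v3, sha16 ae97bda14caca3ee, part 1 of 2; theory seat `hubbard-h0-rotor-theory-1` g12,
# memo ROTOR-THEORY-12 §184, THEOREMS M33; prover seat `hubbard-h0-rotor-p1` g14 — port only, helper `occ` renamed `occNum`)

THEOREM T (tree: `condensateOnFirstSectors_xy_of_symmetricGap`) is conditional on the symmetric-sector gap (H2)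
`SymmetricSectorGap Δ c₁ k` alone.  This file factors (H2) through the TARGET's compressibility hypothesis:

* `SectorGapAtLeast L Δ M g` — the FULL gap of `H(Δ)` above `E(M)` in the sector `Sᶻ_tot = M` is `≥ g` (Temple form over
  real test amplitudes); it implies the tree's (H2) link by link (`symmetricSectorGap_of_sectorGapAtLeast`).
* the FEYNMAN VECTOR `c·a` (`feynmanVec`): the first density wave `c(σ) = Σ_s cos(2π s₀/L) n_s(σ)` times the Perron amplitude;
  `strucC a = ‖c a‖²` (= V·S(k₁)) and `fsumC Δ M a = ⟨c a, (H − E(M)) c a⟩` (= V·f(k₁), f-sum).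
* HYPOTHESIS K `DensityResponseBound L Δ M κ` (static density response at `k₁` ≤ κV, Legendre form) and its single-mode consequence
  K′ `SingleModeResponseBound` (PROVED: `singleMode_of_densityResponse`); HYPOTHESIS F `FsumLower`; HYPOTHESIS R `PhononSaturationBelow`
  (Feynman saturation from below — the residual conjecture).
* PROPOSITION N (PROVED, `sectorGapAtLeast_of_saturation`): K′ ∧ F ∧ R ⇒ `SectorGapAtLeast L Δ M (c_s √(f₀/κ) / L)` — compressibility
  enters T exactly through Cauchy–Schwarz `S(k)² ≤ f(k) χ(k)`.
-/

set_option linter.dupNamespace false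
set_option autoImplicit false

noncomputable section

open Finset Filter Topology
open Literature.MathematicalPhysics.QuantumLattice Literature.Probability.LatticeModels
open Summit.HubbardSuperconductivity.HubbardSuperconductivity.Theorems.AnisotropyChord.InsertionEntropy
open Summit.HubbardSuperconductivity.HubbardSuperconductivity.Theorems.AnisotropyChord.Tower

namespace Summit.HubbardSuperconductivity.HubbardSuperconductivity.Theorems.AnisotropyChord.Transfer



variable (L : ℕ) [NeZero L]

/-- occupation number `n_s(σ) ∈ {0, 1}` of site `s` (the `Fin 2` value read in `ℝ`). [folklore] -/
def occNum (σ : TensorIndex (TorusSite 2 L) 2) (s : TorusSite 2 L) : ℝ := ((σ s : ℕ) : ℝ)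

/-- the first density wave along axis 0: `c(σ) = Σ_s cos(2π s₀ / L) n_s(σ)`. [folklore] -/
def cosWave (σ : TensorIndex (TorusSite 2 L) 2) : ℝ :=
  ∑ s : TorusSite 2 L, Real.cos (2 * Real.pi * ((s 0).val : ℝ) / (L : ℝ)) * occNum L σ s

/-- the FEYNMAN (single-mode) vector `c·a`. [folklore: Feynman 1954, Bijl 1940] -/
def feynmanVec (a : TensorIndex (TorusSite 2 L) 2 → ℝ) : TensorIndex (TorusSite 2 L) 2 → ℝ :=
  fun σ => cosWave L σ * a σ

/-- unnormalised structure factor `‖c a‖² = V·S(k₁)`. [folklore] -/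
def strucC (a : TensorIndex (TorusSite 2 L) 2 → ℝ) : ℝ := ∑ σ, (feynmanVec L a σ) ^ 2

/-- unnormalised f-sum `⟨c a, (H(Δ) − E(M)) c a⟩ = V·f(k₁)`. [folklore] -/
def fsumC (Δ M : ℝ) (a : TensorIndex (TorusSite 2 L) 2 → ℝ) : ℝ :=
  energyQ L Δ (feynmanVec L a) - sectorE L Δ M * strucC L a

/-- **full sector gap `≥ g` (Temple form):** for every Perron amplitude `a` of the sector `M` and every real unit amplitude `φ`
in the sector, `g (1 − ⟨a, φ⟩²) ≤ ⟨φ, Hφ⟩ − E(M)`. [folklore] -/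
def SectorGapAtLeast (Δ M g : ℝ) : Prop :=
  ∀ a φ : TensorIndex (TorusSite 2 L) 2 → ℝ, IsPerronSectorGroundAmplitude L Δ M a →
    cplx L φ ∈ spinZSector (Λ := TorusSite 2 L) 1 M → ∑ σ, φ σ ^ 2 = 1 →
      g * (1 - (∑ σ, a σ * φ σ) ^ 2) ≤ energyQ L Δ φ - sectorE L Δ M

/-- **HYPOTHESIS K — bounded density response (compressibility) at the first wavevector, Legendre form:**
`2⟨φ, c a⟩ − ⟨φ, (H − E(M)) φ⟩ ≤ κ V` for every real sector amplitude `φ` (the supremum over `φ` is `⟨c a, (H − E)⁻¹ c a⟩`).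
[conjecture: hypothesis of the TARGET (compressibility), theory seat hubbard-h0-rotor-theory-1, cycle 12] -/
def DensityResponseBound (Δ M κ : ℝ) : Prop :=
  ∀ a φ : TensorIndex (TorusSite 2 L) 2 → ℝ, IsPerronSectorGroundAmplitude L Δ M a →
    cplx L φ ∈ spinZSector (Λ := TorusSite 2 L) 1 M →
      2 * (∑ σ, φ σ * feynmanVec L a σ) - (energyQ L Δ φ - sectorE L Δ M * ∑ σ, φ σ ^ 2)
        ≤ κ * (Fintype.card (TorusSite 2 L) : ℝ)

/-- **K′ — single-mode consequence of K:** `‖c a‖⁴ ≤ κ V ⟨c a, (H − E) c a⟩` (Cauchy–Schwarz `S(k)² ≤ f(k) χ(k)`). [folklore] -/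
def SingleModeResponseBound (Δ M κ : ℝ) : Prop :=
  ∀ a : TensorIndex (TorusSite 2 L) 2 → ℝ, IsPerronSectorGroundAmplitude L Δ M a →
    strucC L a ^ 2 ≤ κ * (Fintype.card (TorusSite 2 L) : ℝ) * fsumC L Δ M a

/-- **HYPOTHESIS F — f-sum from below:** `⟨c a, (H − E) c a⟩ ≥ f₀ V / L²` (kinetic energy density `> 0`; routine).
[conjecture: support statement, provable] -/
def FsumLower (Δ M f₀ : ℝ) : Prop :=
  ∀ a : TensorIndex (TorusSite 2 L) 2 → ℝ, IsPerronSectorGroundAmplitude L Δ M a →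
    f₀ * (Fintype.card (TorusSite 2 L) : ℝ) / (L : ℝ) ^ 2 ≤ fsumC L Δ M a

/-- **HYPOTHESIS R — Feynman saturation from below:** the sector gap is at least `c_s ⟨c a,(H − E) c a⟩ / ‖c a‖²`.
[conjecture: theory seat hubbard-h0-rotor-theory-1, cycle 12 — the residual of (H2); OPEN] -/
def PhononSaturationBelow (Δ M cs : ℝ) : Prop :=
  ∀ a : TensorIndex (TorusSite 2 L) 2 → ℝ, IsPerronSectorGroundAmplitude L Δ M a →
    0 < strucC L a ∧
    ∀ φ : TensorIndex (TorusSite 2 L) 2 → ℝ, cplx L φ ∈ spinZSector (Λ := TorusSite 2 L) 1 M → ∑ σ, φ σ ^ 2 = 1 →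
      cs * (fsumC L Δ M a / strucC L a) * (1 - (∑ σ, a σ * φ σ) ^ 2) ≤ energyQ L Δ φ - sectorE L Δ M

variable {L}

/-- the Feynman vector of a sector amplitude lies in the same sector (pointwise products preserve the support). [folklore] -/
theorem feynmanVec_smul_mem {M : ℝ} {a : TensorIndex (TorusSite 2 L) 2 → ℝ}
    (ha : cplx L a ∈ spinZSector (Λ := TorusSite 2 L) 1 M) (t : ℝ) :
    cplx L (t • feynmanVec L a) ∈ spinZSector (Λ := TorusSite 2 L) 1 M := by
  rw [LiebMattis.mem_spinZSector_iff] at ha ⊢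
  intro σ hσ
  apply ha σ
  intro h0
  apply hσ
  have h0' : a σ = 0 := by simpa [cplx] using h0
  simp [cplx, feynmanVec, Pi.smul_apply, smul_eq_mul, h0']

/-- **K ⇒ K′** (`S(k)² ≤ f(k)·χ(k)`): instantiate the Legendre bound at `φ = t·(c a)` and optimise `t`. [folklore] -/
theorem singleMode_of_densityResponse {Δ M κ : ℝ}
    (hK : DensityResponseBound L Δ M κ) : SingleModeResponseBound L Δ M κ := by
  intro a ha
  set S := strucC L a with hS
  set F := fsumC L Δ M a with hF
  set K := κ * (Fintype.card (TorusSite 2 L) : ℝ) with hKdef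
  have hsec : cplx L a ∈ spinZSector (Λ := TorusSite 2 L) 1 M := ha.sector
  -- the Legendre bound along the ray t • (c a):  2 t S − t² F ≤ K  for every t
  have ray : ∀ t : ℝ, 2 * t * S - t ^ 2 * F ≤ K := by
    intro t
    have h := hK a (t • feynmanVec L a) ha (feynmanVec_smul_mem hsec t)
    have e1 : (∑ σ, (t • feynmanVec L a) σ * feynmanVec L a σ) = t * S := by
      simp only [Pi.smul_apply, smul_eq_mul, hS, strucC]
      rw [Finset.mul_sum]; refine Finset.sum_congr rfl fun σ _ => by ring
    have e2 : (∑ σ, (t • feynmanVec L a) σ ^ 2) = t ^ 2 * S := by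
      simp only [Pi.smul_apply, smul_eq_mul, hS, strucC]
      rw [Finset.mul_sum]; refine Finset.sum_congr rfl fun σ _ => by ring
    have e3 : energyQ L Δ (t • feynmanVec L a) = t ^ 2 * energyQ L Δ (feynmanVec L a) := energyQ_smul Δ t _
    rw [e1, e2, e3] at h
    have : energyQ L Δ (feynmanVec L a) = F + sectorE L Δ M * S := by rw [hF]; unfold fsumC; ring
    rw [this] at h
    nlinarith [h]
  -- S ≥ 0, and K ≥ 0 (t = 0)
  have hS0 : 0 ≤ S := by rw [hS]; unfold strucC; positivity
  have hK0 : 0 ≤ K := by simpa using ray 0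
  by_cases hFpos : 0 < F
  · -- optimise: t = S / F
    have h := ray (S / F)
    have hFne : F ≠ 0 := ne_of_gt hFpos
    have : 2 * (S / F) * S - (S / F) ^ 2 * F = S ^ 2 / F := by field_simp; ring
    rw [this] at h
    rw [div_le_iff₀ hFpos] at h
    linarith
  · -- F ≤ 0: the ray bound forces S = 0 (else 2tS → ∞), and then both sides are comparable since F ≥ 0 by the variational floor
    have hFle : F ≤ 0 := not_lt.1 hFpos
    have hF0 : 0 ≤ F := by
      rw [hF]; unfold fsumC
      have hv := sectorE_mul_le_energyQ Δ M (feynmanVec L a) (fun σ hσ => ?_)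
      · unfold strucC; linarith
      · -- support of the Feynman vector ⊆ support of a
        have hne : a σ ≠ 0 := by
          intro h0; apply hσ; simp [feynmanVec, h0]
        exact zerosCard_of_mem_spinZSector hsec σ hne
    have hFz : F = 0 := le_antisymm hFle hF0
    have hSz : S = 0 := by
      by_contra hne
      have hSpos : 0 < S := lt_of_le_of_ne hS0 (Ne.symm hne)
      have h := ray ((K + 1) / (2 * S))
      rw [hFz] at h
      have : 2 * ((K + 1) / (2 * S)) * S = K + 1 := by field_simp
      rw [this] at h; linarith
    rw [hSz, hFz]; simp

/-- **PROPOSITION N (compressibility ⇒ Feynman scale; saturation ⇒ gap):** K′ ∧ F ∧ R give the full sector gap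
`≥ c_s √(f₀/κ) / L`. [conjecture: theory seat hubbard-h0-rotor-theory-1, cycle 12 — PROVED here] -/
theorem sectorGapAtLeast_of_saturation {Δ M κ f₀ cs : ℝ} (hκ : 0 < κ) (hcs : 0 ≤ cs)
    (hK : SingleModeResponseBound L Δ M κ) (hFl : FsumLower L Δ M f₀) (hR : PhononSaturationBelow L Δ M cs) :
    SectorGapAtLeast L Δ M (cs * Real.sqrt (f₀ / κ) / (L : ℝ)) := by
  intro a φ ha hφ hφ1
  obtain ⟨hSpos, hRφ⟩ := hR a ha
  have hgap := hRφ φ hφ hφ1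
  set S := strucC L a with hS
  set F := fsumC L Δ M a with hF
  set V : ℝ := (Fintype.card (TorusSite 2 L) : ℝ) with hV
  have hLpos : 0 < (L : ℝ) := by exact_mod_cast Nat.pos_of_ne_zero (NeZero.ne L)
  have hVpos : 0 < V := by
    rw [hV]; exact_mod_cast Fintype.card_pos
  have hK' : S ^ 2 ≤ κ * V * F := hK a ha
  have hFl' : f₀ * V / (L : ℝ) ^ 2 ≤ F := hFl a ha
  -- F > 0 from K′ and S > 0
  have hFpos : 0 < F := by
    by_contra h
    have hFle : F ≤ 0 := not_lt.1 h
    have : S ^ 2 ≤ 0 := le_trans hK' (by nlinarith [mul_pos hκ hVpos])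
    nlinarith [hSpos]
  -- (F/S)² ≥ F/(κ V) ≥ f₀/(κ L²)
  have hq : f₀ / κ / (L : ℝ) ^ 2 ≤ (F / S) ^ 2 := by
    have h1 : (F / S) ^ 2 = F * F / S ^ 2 := by rw [div_pow]; ring
    have h2 : F / (κ * V) ≤ F * F / S ^ 2 := by
      rw [div_le_div_iff₀ (mul_pos hκ hVpos) (by positivity)]
      nlinarith [hK', hFpos.le]
    have h3 : f₀ / κ / (L : ℝ) ^ 2 ≤ F / (κ * V) := by
      rw [div_div, div_le_div_iff₀ (by positivity) (mul_pos hκ hVpos)]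
      have := mul_le_mul_of_nonneg_left hFl' (le_of_lt (mul_pos hκ hVpos))
      have e : κ * V * (f₀ * V / (L : ℝ) ^ 2) = f₀ * (κ * V) * V / (L : ℝ) ^ 2 := by ring
      rw [e, div_le_iff₀ (by positivity)] at this
      nlinarith [this]
    rw [h1]; exact le_trans h3 h2
  have hFS : 0 ≤ F / S := le_of_lt (div_pos hFpos hSpos)
  have hroot : Real.sqrt (f₀ / κ) / (L : ℝ) ≤ F / S := by
    have e : Real.sqrt (f₀ / κ) / (L : ℝ) = Real.sqrt (f₀ / κ / (L : ℝ) ^ 2) := by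
      rw [Real.sqrt_div' (f₀ / κ) (pow_nonneg hLpos.le 2), Real.sqrt_sq hLpos.le]
    rw [e]
    calc Real.sqrt (f₀ / κ / (L : ℝ) ^ 2) ≤ Real.sqrt ((F / S) ^ 2) := Real.sqrt_le_sqrt hq
      _ = F / S := Real.sqrt_sq hFS
  -- overlap² ≤ 1 (Cauchy–Schwarz), so the weaker constant still bounds
  have hov : (∑ σ, a σ * φ σ) ^ 2 ≤ 1 := by
    have h := Finset.sum_mul_sq_le_sq_mul_sq (Finset.univ) a φ
    rw [ha.unit, hφ1] at h; simpa using h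
  have hfac : 0 ≤ 1 - (∑ σ, a σ * φ σ) ^ 2 := by linarith
  calc cs * Real.sqrt (f₀ / κ) / (L : ℝ) * (1 - (∑ σ, a σ * φ σ) ^ 2)
      = cs * (Real.sqrt (f₀ / κ) / (L : ℝ)) * (1 - (∑ σ, a σ * φ σ) ^ 2) := by ring
    _ ≤ cs * (F / S) * (1 - (∑ σ, a σ * φ σ) ^ 2) := by
        apply mul_le_mul_of_nonneg_right _ hfac
        exact mul_le_mul_of_nonneg_left hroot hcs
    _ ≤ energyQ L Δ φ - sectorE L Δ M := hgap

/-- **a full sector gap `≥ c₁/L` on the first `k + 1` sectors, eventually in `L`, gives the tree's (H2)** (drop the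
translation-invariance restriction of the test amplitude). [folklore] -/
theorem symmetricSectorGap_of_sectorGapAtLeast {Δ c₁ : ℝ} {k : ℕ}
    (h : ∀ᶠ L : ℕ in atTop, ∀ [NeZero L], ∀ j : ℤ, |j| ≤ (k : ℤ) → SectorGapAtLeast L Δ (j : ℝ) (c₁ / (L : ℝ))) :
    SymmetricSectorGap Δ c₁ k := by
  unfold SymmetricSectorGap
  filter_upwards [h] with L hL
  intro _ j hj a φ ha hφ _ hφ1
  exact hL j hj a φ ha hφ hφ1

end Summit.HubbardSuperconductivity.HubbardSuperconductivity.Theorems.AnisotropyChord.Transfer
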